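import Summits.HodgeConjecture.HodgeConjecture.Theorems.NikulinTwinTransportHodgeSimilitudeAlgebraicAnchors
import Summits.HodgeConjecture.HodgeConjecture.Theorems.NikulinTwinTransportTwinSimilitudeAlgebraicLattice
import Summits.HodgeConjecture.HodgeConjecture.Theorems.NikulinTwinTransportTwinSimilitudeReduction

/-!
# Route NikulinTwinTransport · crux `TwinTwistorTransport` (stmt-HodgeConjecture-14393) —
# the typed crux BY NAME from twin transport at multiplier `2`, and conversely

The crux is typed at OUTPUT level (rev 7): every projective K3 surface `S` with integral generator
`p` of `H⁴` has a projective K3 partner `S″`, a generator `p″` and an ALGEBRAIC `ℂ`-linear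
equivalence `Ψ : H²(S″(ℂ); ℂ) ≃ H²(S(ℂ); ℂ)` whose inverse is rational, type-preserving and halves the
cup form (`AnchorAt[2]` of `NikulinTwinTransportHodgeSimilitudeAlgebraicAnchors`). This file
connects the route DECLARATION `Theses.NikulinTwinTransport.TwinTwistorTransport` to the tree's
lattice-level machinery (the planner's K2-RETARGET: "lattice-level lines re-target via
`anchorAt_of_twinTransport` + 3 K3 facts as stubs"):

* `twinTwistorTransport_of_twinTransport` — the three K3 facts (`Huybrechts_K3_periodSurjective_projective`,
  `Huybrechts_K3_marking_exists`, `Huybrechts_K3_hodgeTypes_H2`; named, unproved Literature facts)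
  and twin transport for ONE rational `2`-similitude `M` of `Λ_{K3} ⊗ ℂ` with rational two-sided
  inverse `N` (the twin similitude `η⁻¹ ∘ M ∘ η′` is induced by an algebraic class on every `M`-twin
  pair of marked projective K3 surfaces) imply `TwinTwistorTransport` (`anchorAt_of_twinTransport`,
  `c = 2`);
* `twinTwistorTransport_of_ratTwinTransport` — the same with the lattice part discharged
  (`exists_twoSimilitude_k3Lattice`): the three K3 facts + twin transport for every rational
  `2`-similitude with rational inverse ⟹ the crux;
* `ratTwinTransport_of_twinTwistorTransport` — conversely the crux, Buskin's theorem
  (`HodgeIsometryAlgebraic`, item 13675), the composition of algebraic correspondences between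
  smooth projective surfaces and `Huybrechts_K3_hodgeTypes_H2` give twin transport for EVERY
  rational `2`-similitude of `Λ_ℂ` (`twinSimilitudeAlgebraic_of_anchor` then
  `twinTransport_of_twinSimilitudeAlgebraic`);
* `twinTwistorTransport_iff_ratTwinTransport` — the equivalence, modulo Buskin, the composition of
  correspondences and the three K3 facts.

So the research content of the crux is exactly ONE twin transport at multiplier `2` — an open
sub-case of the Hodge conjecture in print (Varesco, Math. Z. 305 (2023) Thm. 2.1: known on the
Nikulin locus only). Nothing here proves any twin transport; every result is conditional on the
named K3 facts it lists. Lead prover of line `Sketch` (skeleton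
`Cruxes/TwinTwistorTransport/Lines/Sketch.lean`, stub `stub_twinTransport`), 2026-08-16.
-/

noncomputable section

open CategoryTheory MonoidalCategory
open scoped Manifold
open Literature.AlgebraicGeometry.Motives Literature.AlgebraicGeometry.HodgeTheory
open Literature.AlgebraicGeometry.Surfaces Literature.Geometry.Kaehler
open Literature.AlgebraicTopology.SingularHomology
open Summit.HodgeConjecture.HodgeConjecture.Theses.NikulinTwinTransport

namespace Summit.HodgeConjecture.HodgeConjecture.Theorems.NikulinTwinTransport

/-! ### Local notations (verbatim those of `NikulinTwinTransportHodgeSimilitudeAlgebraicTwinTransport`) -/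

/-- `MarkedK3[S, η, p, x]`: a marked K3 surface with period `x`. Local notation only. -/
local notation3 (prettyPrint := false) "MarkedK3[" S ", " η ", " p ", " x "]" =>
  (IsIntegralClass p ∧
    (∀ q : complexBetti S (2 * 2), IsIntegralClass q → ∃ n : ℤ, q = n • p) ∧
    (∀ c : complexBetti S (2 * 1), IsIntegralClass c ↔ ∃ v : K3Index → ℤ, η c = fun i => (v i : ℂ)) ∧
    (∀ a b : complexBetti S (2 * 1),
        cupProduct (rfl : 2 * 1 + 2 * 1 = 2 * 2) a b = k3Form (η a) (η b) • p) ∧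
    IsOfHodgeType 2 S (2 * 1) 2 0 (LinearEquiv.symm η x) ∧
    (∀ τ : complexBetti S (2 * 1), IsOfHodgeType 2 S (2 * 1) 2 0 τ → ∃ t : ℂ, τ = t • LinearEquiv.symm η x))

/-- `PeriodPt[x]`: a projective period point. Local notation only. -/
local notation3 (prettyPrint := false) "PeriodPt[" x "]" =>
  (k3Form x x = 0 ∧ 0 < (k3Form (star x) x).re ∧
    ∃ u : K3Index → ℤ, k3Form (fun i => (u i : ℂ)) x = 0 ∧ 0 < ∑ i, ∑ j, u i * k3Gram i j * u j)

/-- `Corr[μ, S, S', hS, hS' ; γ, y] = [γ]_* y`. Local notation only. -/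
local notation3 (prettyPrint := false) "Corr[" μ ", " S ", " S' ", " hS ", " hS' " ; " γ ", " y "]" =>
  complexGysin μ
    (IsSmoothProjective.tensor_holds (IsK3Surface.isSmoothProjective hS)
      (IsK3Surface.isSmoothProjective hS'))
    (IsK3Surface.isSmoothProjective hS) (SemiCartesianMonoidalCategory.fst S S')
    (rfl : 2 * 1 + 2 * 2 + 2 * 2 = 2 * 1 + 2 * (2 + 2))
    (cupProduct (rfl : 2 * 1 + 2 * 2 = 2 * 1 + 2 * 2)
      (complexBetti.map (SemiCartesianMonoidalCategory.snd S S') (2 * 1) y) γ)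

/-- `TwinTransportFor[M]`: the twin transport for the endomorphism `M` of `Λ_ℂ`. Local notation only. -/
local notation3 (prettyPrint := false) "TwinTransportFor[" M "]" =>
  ∀ (μ : OrientationFamily), μ.HasPoincareDuality →
    ∀ (S S' : SchemeOver ℂ) (hS : IsK3Surface S) (hS' : IsK3Surface S')
      (η : complexBetti S (2 * 1) ≃ₗ[ℂ] (K3Index → ℂ)) (p : complexBetti S (2 * 2))
      (x : K3Index → ℂ)
      (η' : complexBetti S' (2 * 1) ≃ₗ[ℂ] (K3Index → ℂ)) (p' : complexBetti S' (2 * 2))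
      (x' : K3Index → ℂ),
      MarkedK3[S, η, p, x] → PeriodPt[x] → MarkedK3[S', η', p', x'] → PeriodPt[x'] →
      (∃ t : ℂ, M x' = t • x) →
      ∃ γ ∈ algebraicClasses (MonoidalCategoryStruct.tensorObj S S') 2,
        ∀ y : complexBetti S' (2 * 1), η.symm (M (η' y)) = Corr[μ, S, S', hS, hS' ; γ, y]

/-- `RatTwinTransportAt[c]`: twin transport for EVERY `ℂ`-linear `c`-similitude `M` of
`(Λ_ℂ, k3Form)` defined over `ℚ` with a two-sided inverse defined over `ℚ`. Local notation only. -/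
local notation3 (prettyPrint := false) "RatTwinTransportAt[" c "]" =>
  ∀ (M N : Module.End ℂ (K3Index → ℂ)),
    (∀ v : K3Index → ℤ, ∃ w : K3Index → ℚ, M (fun i => (v i : ℂ)) = fun i => (w i : ℂ)) →
    (∀ v : K3Index → ℤ, ∃ w : K3Index → ℚ, N (fun i => (v i : ℂ)) = fun i => (w i : ℂ)) →
    M * N = 1 → N * M = 1 → (∀ a b, k3Form (M a) (M b) = c * k3Form a b) → TwinTransportFor[M]

/-- `CompCorr`: composition of algebraic correspondences between smooth projective surfaces. Local
notation only, verbatim from `NikulinTwinTransportHodgeSimilitudeAlgebraicPrimes`. -/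
local notation3 (prettyPrint := false) "CompCorr" =>
  ∀ (μ : OrientationFamily), μ.HasPoincareDuality →
    ∀ (A B C : SchemeOver ℂ) (hA : IsSmoothProjective 2 A) (hB : IsSmoothProjective 2 B)
      (hC : IsSmoothProjective 2 C),
      ∀ γ ∈ algebraicClasses (MonoidalCategoryStruct.tensorObj A B) 2,
        ∀ γ₁ ∈ algebraicClasses (MonoidalCategoryStruct.tensorObj B C) 2,
          ∃ γ₂ ∈ algebraicClasses (MonoidalCategoryStruct.tensorObj A C) 2,
            ∀ x : complexBetti C (2 * 1),
              complexGysin μ (IsSmoothProjective.tensor_holds hA hC) hA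
                  (SemiCartesianMonoidalCategory.fst A C)
                  (rfl : 2 * 1 + 2 * 2 + 2 * 2 = 2 * 1 + 2 * (2 + 2))
                  (cupProduct (rfl : 2 * 1 + 2 * 2 = 2 * 1 + 2 * 2)
                    (complexBetti.map (SemiCartesianMonoidalCategory.snd A C) (2 * 1) x) γ₂) =
                complexGysin μ (IsSmoothProjective.tensor_holds hA hB) hA
                  (SemiCartesianMonoidalCategory.fst A B)
                  (rfl : 2 * 1 + 2 * 2 + 2 * 2 = 2 * 1 + 2 * (2 + 2))
                  (cupProduct (rfl : 2 * 1 + 2 * 2 = 2 * 1 + 2 * 2)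
                    (complexBetti.map (SemiCartesianMonoidalCategory.snd A B) (2 * 1)
                      (complexGysin μ (IsSmoothProjective.tensor_holds hB hC) hB
                        (SemiCartesianMonoidalCategory.fst B C)
                        (rfl : 2 * 1 + 2 * 2 + 2 * 2 = 2 * 1 + 2 * (2 + 2))
                        (cupProduct (rfl : 2 * 1 + 2 * 2 = 2 * 1 + 2 * 2)
                          (complexBetti.map (SemiCartesianMonoidalCategory.snd B C) (2 * 1) x)
                          γ₁)))
                    γ)

/-! ### The crux from one twin transport at multiplier `2` -/

/-- **The typed crux `TwinTwistorTransport` from ONE twin transport at multiplier `2`.** Granted the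
three K3 facts — surjectivity of the period map in projective form, existence of markings with
projective period, and the Hodge types of `H²(K3)` (named, unproved Literature facts) — and a
`ℂ`-linear `2`-similitude `M` of `(Λ_ℂ, k3Form)` with a two-sided inverse `N` defined over `ℚ`
whose twin similitude `η⁻¹ ∘ M ∘ η″` is induced by an algebraic class on every `M`-twin pair of
marked projective K3 surfaces, every projective K3 surface `S` with integral generator `p` of `H⁴`
has a projective K3 partner `S″`, a generator `p″`, and an ALGEBRAIC `ℂ`-linear equivalence
`Ψ : H²(S″) ≃ H²(S)` whose inverse is rational, type-preserving and halves the cup form — the route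
declaration `TwinTwistorTransport`, by `anchorAt_of_twinTransport` at `c = 2` (mark `S`, realise
the twin period `N x` by a marked projective `S″`, `Ψ = η⁻¹ ∘ M ∘ η″`, `Ψ⁻¹ = η″⁻¹ ∘ N ∘ η`).
[cite: Buskin2019, §6.2] [cite: Varesco2023, §2 (proof of Thm. 2.1)]
[cite: Huybrechts2016K3, Ch. 1 Prop. 3.5, Ch. 6 Prop. 1.2 and Rem. 3.3, Ch. 7 Thm. 4.1] -/
theorem twinTwistorTransport_of_twinTransport
    (hP : Huybrechts_K3_periodSurjective_projective) (hMk : Huybrechts_K3_marking_exists)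
    (hHT : Huybrechts_K3_hodgeTypes_H2) (M N : Module.End ℂ (K3Index → ℂ))
    (hNrat : ∀ v : K3Index → ℤ, ∃ w : K3Index → ℚ, N (fun i => (v i : ℂ)) = fun i => (w i : ℂ))
    (hMN : M * N = 1) (hNM : N * M = 1) (hM2 : ∀ a b, k3Form (M a) (M b) = 2 * k3Form a b)
    (htw : TwinTransportFor[M]) : TwinTwistorTransport := by
  have h := anchorAt_of_twinTransport 2 two_pos hP hMk hHT M N hNrat hMN hNM
    (fun a b => by rw [Rat.cast_ofNat]; exact hM2 a b) htw
  rw [Rat.cast_ofNat] at h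
  exact h

/-- **The typed crux from twin transport at multiplier `2`, lattice part discharged.** The three K3
facts and twin transport for every `ℂ`-linear `2`-similitude of `(Λ_ℂ, k3Form)` defined over `ℚ`
with a two-sided inverse defined over `ℚ` imply `TwinTwistorTransport`: such a similitude exists
(`exists_twoSimilitude_k3Lattice`: sum/difference on `E₈(−1)^{⊕2}`, `diag(1,2)` on each `U`), and
`twinTwistorTransport_of_twinTransport` applies to it. [cite: Huybrechts2016K3, Ch. 1 §3.3 and Ch. 14 §0.2 (the K3 lattice)] -/
theorem twinTwistorTransport_of_ratTwinTransport
    (hP : Huybrechts_K3_periodSurjective_projective) (hMk : Huybrechts_K3_marking_exists)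
    (hHT : Huybrechts_K3_hodgeTypes_H2) (htw : RatTwinTransportAt[(2 : ℂ)]) :
    TwinTwistorTransport := by
  obtain ⟨M, N, hMrat, hNrat, hMN, hNM, hM2⟩ := exists_twoSimilitude_k3Lattice
  exact twinTwistorTransport_of_twinTransport hP hMk hHT M N hNrat hMN hNM hM2
    (htw M N hMrat hNrat hMN hNM hM2)

/-! ### Conversely: the crux gives twin transport at multiplier `2` -/

/-- **The crux gives twin transport for every rational `2`-similitude of the K3 lattice**, granted
Buskin's theorem (`HodgeIsometryAlgebraic`, item stmt-HodgeConjecture-13675), the composition of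
algebraic degree-`2` correspondences between smooth projective surfaces, and the Hodge types of
`H²(K3)`: the crux is verbatim the anchor hypothesis (A) of `twinSimilitudeAlgebraic_of_anchor`, so
X = `TwinSimilitudeAlgebraic` holds (`Ψ⁻¹ ∘ ψ` is a rational Hodge isometry, Buskin, compose), and
X makes the twin similitude `η⁻¹ ∘ M ∘ η′` of every rational `2`-similitude `M` algebraic on every
`M`-twin pair (`twinTransport_of_twinSimilitudeAlgebraic`: it is rational, type-preserving and a
`2`-similitude for the generators of the markings). The hypotheses "`M` has a rational two-sided
inverse" of `RatTwinTransportAt` are not used in this direction.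
[cite: Varesco2023, §2] [cite: Buskin2019, Thm. 1.1, §6.2 Lemma 6.3] -/
theorem ratTwinTransport_of_twinTwistorTransport (hB : HodgeIsometryAlgebraic) (hC : CompCorr)
    (hHT : Huybrechts_K3_hodgeTypes_H2) (h : TwinTwistorTransport) : RatTwinTransportAt[(2 : ℂ)] := by
  intro M N hMrat _ _ _ hM2
  have hX : TwinSimilitudeAlgebraic := twinSimilitudeAlgebraic_of_anchor hB hC h
  intro μ hμ S S' hS hS' η p x η' p' x' hm hx hm' hx' hper
  exact twinTransport_of_twinSimilitudeAlgebraic hHT hX M hMrat hM2 μ hμ S S' hS hS' η p x η' p' x'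
    hm hx hm' hx' hper

/-- **The crux `TwinTwistorTransport` is EQUIVALENT to twin transport at multiplier `2`** (for every
rational `2`-similitude of the K3 lattice with rational inverse), modulo Buskin's theorem
(`HodgeIsometryAlgebraic`), the composition of algebraic correspondences between smooth projective
surfaces and the three K3 facts. So the research content of the typed crux is one twin transport
at multiplier `2` — in print an open sub-case of the Hodge conjecture (Varesco 2023 Thm. 2.1 covers
the Nikulin locus). [cite: Varesco2023, §2 and Thm. 2.1] [cite: Buskin2019, §6.2] -/
theorem twinTwistorTransport_iff_ratTwinTransport (hB : HodgeIsometryAlgebraic) (hC : CompCorr)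
    (hP : Huybrechts_K3_periodSurjective_projective) (hMk : Huybrechts_K3_marking_exists)
    (hHT : Huybrechts_K3_hodgeTypes_H2) :
    TwinTwistorTransport ↔ RatTwinTransportAt[(2 : ℂ)] :=
  ⟨ratTwinTransport_of_twinTwistorTransport hB hC hHT,
    twinTwistorTransport_of_ratTwinTransport hP hMk hHT⟩

/-- **Registered sub-goal `cruxOfTwinTransportAtTwo` of the line `Sketch`** (crux
stmt-HodgeConjecture-14393): the three K3 facts and twin transport at multiplier `2` (for every
rational `2`-similitude of the K3 lattice with rational inverse) imply the route declaration
`TwinTwistorTransport` — `twinTwistorTransport_of_ratTwinTransport` under the registered name.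
[cite: Buskin2019, §6.2] [cite: Varesco2023, §2] -/
theorem cruxOfTwinTransportAtTwo :
    Huybrechts_K3_periodSurjective_projective → Huybrechts_K3_marking_exists →
    Huybrechts_K3_hodgeTypes_H2 → RatTwinTransportAt[(2 : ℂ)] → TwinTwistorTransport :=
  twinTwistorTransport_of_ratTwinTransport

end Summit.HodgeConjecture.HodgeConjecture.Theorems.NikulinTwinTransport

end
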